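import Mathlib
import Literature.MathematicalPhysics.QuantumFieldTheory.Balaban1983to89.B12Average012Covariance
import Literature.MathematicalPhysics.QuantumFieldTheory.Balaban1983to89.B12Average012Prop2

/-!
# `Balaban1983to89.B12Average012CovarianceIter` — [Balaban1987RG1] p. 254 / [Balaban1985Averaging] (11): GAUGE
# COVARIANCE OF THE `k`-FOLD (0.12)/(0.11) AVERAGE, `\overline{(U^g)}^j = (Ū^j)^{g∘(L^j·)}` for `j ≤ k`, and gauge
# INVARIANCE of the regularity functional (52) and of the conclusion (54) of [B7] Proposition 2 — PROVED for the
# b12 lineage's concrete average (unitary configurations in a C⋆-algebra)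

HONEST FRAMING (cell `lit-balaban`, verbatim): statement-level skeleton of published theorems with citation tags;
proofs where landed; nothing here is a claim about the Yang–Mills mass gap.

CITATION HEADER.  T. Bałaban, *Renormalization group approach to lattice gauge field theories. I*, Commun. Math.
Phys. **109** (1987) 249–301, doi:10.1007/bf01215223 [Balaban1987RG1] (cell paper B12 = «[I]»); p. 254 [PDF 6]
re-read this generation from the held text (`paper:balaban1987-cmp109-rg-i-small-field`).  [12] = [B7] =
[Balaban1985Averaging], Commun. Math. Phys. **98** (1985) 17–51: (11) p. 19 (gauge covariance of the averaging
operation), (43) p. 24 (`Ū^j`), (45) p. 24 («|V₀(∂p) − 1| = |V(∂p) − 1|»), Prop. 2 (52)–(54) p. 26 — through the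
tree.  Unit `lit-balaban-r09` gen 9 (display owner of CMP 109; TAKING line `HOME/STATUS.md` 2026-08-21T09:1xZ), HOME
`run/shared/lean/pub/lit-balaban/`; SKELETON rows `B12.Eq0.12`, `B12.Eq0.13` (cells only).

WHAT IS PRINTED (verbatim, [I] p. 254).  *«Here U, V are gauge field configurations on the lattices T, T^{(1)}
correspondingly, and t(V, U) is a gauge invariant kernel, for example see the definitions in [9, 12]. If ρ is a
gauge invariant function, then Tρ is gauge invariant also. … configurations satisfying bounds |U(∂p) − 1| < ε₀,
p ∈ T … Even with these restrictions the underintegral expression in (0.13) is still invariant with respect to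
the gauge transformations u …»*; and p. 254 after (0.12): *«all results of the paper [12] are valid for it»* — of
which (11) (gauge covariance, one step: `B12Average012Covariance`) is here iterated along (43).

DICTIONARY print → Lean (all PRE-EXISTING).  Gauge transformation `U^g(⟨x, x+e_μ⟩) = g(x)U(⟨x,x+e_μ⟩)g(x+e_μ)⁻¹` ↦
`QuantumLattice.gaugeTransformZd g U`; `Ū` ↦ `B12SmallFieldRegion255.avgBar`; `Ū^j` ↦ `B12Average012Prop2.avgIter012`;
`sup_p‖U(∂p) − 1‖` ↦ `B12Average012Prop2.pdevZ`; the corner `L^j y` of the `L^j`-cube `y` ↦ `QuantumLattice.blockBase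
(L^j) y`; `G` = the unitary group of a C⋆-algebra ↦ `B7Prop2Explicit.unitaryUnits`.

THE ARGUMENT FORMALISED.  § 2: `‖U^g(∂p) − 1‖ = ‖U(∂p) − 1‖` for `U1`-valued `g` (conjugation by a contraction
both ways), so `pdevZ (U^g) = pdevZ U`; the one-step covariance `Ū^g(c) = g(Lc₋)Ū(c)g(Lc₊)⁻¹` of
`B12Average012Covariance.avgBar_gaugeTransformZd` in configuration form `\overline{U^g} = Ū^{g∘(L·)}`.  § 3:
induction on `j ≤ k`: `\overline{(U^g)}^{j+1} = \overline{(Ū^j)^{g∘(L^j·)}} = (Ū^{j+1})^{g∘(L^j·)∘(L·)} =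
(Ū^{j+1})^{g∘(L^{j+1}·)}`, the one-step covariance being applicable at level `j` because, by [B7] Prop. 2 for the
(0.12)/(0.11) average (`B12Average012Prop2.prop2_012`, `prop2_012_lt_two` at `k := j`), `Ū^j` is unitary and
`ε`-regular with `(dL)²ε ≤ (dL)²·2α₀ ≤ 1/512`.

WHAT IS PROVED (kernel-checked, no `sorry`, axioms `propext`, `Classical.choice`, `Quot.sound`; NO definition, NO
`Prop` placeholder, net new unproved facts 0): `blockBase_blockBase`, `comp_blockBase_pow_succ`,
`norm_plaq_gaugeTransformZd_sub_one_eq`, **`pdevZ_gaugeTransformZd`**, `avgBar_gaugeTransformZd_cfg`,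
**`avgIter012_gaugeTransformZd`**, **`prop2_012_gaugeTransformZd`**.

DIVERGENCES FROM PRINT / WHAT IS NOT PROVED (honest scope).  (a) As `B12Average012Covariance` (a)–(d) and
`B12Average012Prop2` (a)–(c): `ℤᵈ` corner cubes, the lineage's (0.10)–(0.12), unitary configurations in a
C⋆-algebra, weak inequalities, regularity on all plaquettes.  (b) The `k`-fold covariance is stated under the
hypotheses of [B7] Prop. 2 (which guarantee that every level stays in the domain where the one-step covariance is
proved); print treats covariance as automatic.  (c) Nothing about the kernels `t(V,U)` of (0.13) or the
renormalization transformations themselves (`B12RTGaugeInvariance254`).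
-/

noncomputable section

open NormedSpace Finset

namespace Literature.MathematicalPhysics.QuantumFieldTheory.Balaban1983to89.B12Average012CovarianceIter

open Literature.MathematicalPhysics.QuantumLattice (ZdEdge blockBase blockBase_one plaquetteHolonomyZd gaugeTransformZd
  plaquetteHolonomyZd_gaugeTransformZd)
open B7Prop1Explicit (U1 mem_U1 norm_units_conj_sub_one_le)
open B7Prop2Explicit (unitaryUnits mem_unitaryUnits unitaryUnits_le_U1 c2')
open B12SmallFieldRegion255 (avgBar)
open B12Average012Covariance (avgBar_gaugeTransformZd)
open B12Average012Prop2 (pdevZ pdevZ_nonneg le_pdevZ C0A avgIter012 avgIter012_zero avgIter012_succ prop2_012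
  prop2_012_lt_two)

variable {d : ℕ}

/-! ## § 1  Block corners compose: `L^j·(L·y) = L^{j+1}·y` -/

/-- [cite: Balaban1987RG1, (0.1) p.251] the lattices of cubes of sizes `L^j` are nested: `blockBase M (blockBase N y)
= blockBase (M·N) y` (elementary API). -/
theorem blockBase_blockBase (M N : ℕ) (y : Fin d → ℤ) : blockBase M (blockBase N y) = blockBase (M * N) y := by
  funext i
  simp only [blockBase, Nat.cast_mul, mul_assoc]

/-- [cite: Balaban1987RG1, (0.1) p.251] `g ∘ (L^j·) ∘ (L·) = g ∘ (L^{j+1}·)` (elementary API). -/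
theorem comp_blockBase_pow_succ {X : Type*} (g : (Fin d → ℤ) → X) (L j : ℕ) :
    (g ∘ blockBase (L ^ j)) ∘ blockBase L = g ∘ blockBase (L ^ (j + 1)) := by
  funext y
  simp only [Function.comp_apply, blockBase_blockBase, pow_succ]

/-! ## § 2  Gauge invariance of the regularity functional (52) -/

section Normed

variable {𝔸 : Type*} [NormedRing 𝔸] [NormedAlgebra ℂ 𝔸] [NormOneClass 𝔸] [CompleteSpace 𝔸] {L : ℕ}

omit [NormedAlgebra ℂ 𝔸] [CompleteSpace 𝔸] in
/-- [cite: Balaban1985Averaging, (45) p.24] «|V₀(∂p) − 1| = |V(∂p) − 1|»: plaquette regularity is gauge INVARIANT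
for `U1`-valued gauge functions (equality: the inequality of `B12Average012Covariance.norm_plaq_gaugeTransformZd_sub_one_le`
for `g` and for `g⁻¹`). -/
theorem norm_plaq_gaugeTransformZd_sub_one_eq (U : ZdEdge d → 𝔸ˣ) {g : (Fin d → ℤ) → 𝔸ˣ}
    (hg : ∀ z, g z ∈ U1 𝔸) (p : Fin d → ℤ) (i j : Fin d) :
    ‖((plaquetteHolonomyZd (gaugeTransformZd g U) p i j : 𝔸ˣ) : 𝔸) - 1‖
      = ‖((plaquetteHolonomyZd U p i j : 𝔸ˣ) : 𝔸) - 1‖ := by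
  refine le_antisymm (B12Average012Covariance.norm_plaq_gaugeTransformZd_sub_one_le U hg p i j) ?_
  rw [plaquetteHolonomyZd_gaugeTransformZd, Units.val_mul, Units.val_mul]
  have h := norm_units_conj_sub_one_le ((U1 𝔸).inv_mem (hg p))
    (((g p : 𝔸ˣ) : 𝔸) * ((plaquetteHolonomyZd U p i j : 𝔸ˣ) : 𝔸) * (((g p)⁻¹ : 𝔸ˣ) : 𝔸))
  have e : (((g p)⁻¹ : 𝔸ˣ) : 𝔸) * (((g p : 𝔸ˣ) : 𝔸) * ((plaquetteHolonomyZd U p i j : 𝔸ˣ) : 𝔸)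
      * (((g p)⁻¹ : 𝔸ˣ) : 𝔸)) * ((((g p)⁻¹)⁻¹ : 𝔸ˣ) : 𝔸) = ((plaquetteHolonomyZd U p i j : 𝔸ˣ) : 𝔸) := by
    simp only [← Units.val_mul]
    congr 1
    group
  rw [e] at h
  exact h

omit [NormedAlgebra ℂ 𝔸] [CompleteSpace 𝔸] in
/-- [cite: Balaban1985Averaging, (52) p.26] the regularity functional `sup_p ‖U(∂p) − 1‖` of (52) is gauge
invariant: `sup_p ‖U^g(∂p) − 1‖ = sup_p ‖U(∂p) − 1‖` (`U1`-valued `g`). -/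
theorem pdevZ_gaugeTransformZd (U : ZdEdge d → 𝔸ˣ) {g : (Fin d → ℤ) → 𝔸ˣ} (hg : ∀ z, g z ∈ U1 𝔸) :
    pdevZ (gaugeTransformZd g U) = pdevZ U := by
  rw [pdevZ, pdevZ]
  simp only [norm_plaq_gaugeTransformZd_sub_one_eq U hg]

/-- [cite: Balaban1987RG1, (0.12) p.254][cite: Balaban1985Averaging, (11) p.19] the one-step covariance of
`B12Average012Covariance.avgBar_gaugeTransformZd` in configuration form: `\overline{U^g} = Ū^{g∘(L·)}` — the
averaged configuration transforms with the gauge function RESTRICTED TO THE BLOCK CORNERS `g(Ly)`. -/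
theorem avgBar_gaugeTransformZd_cfg (hL : 0 < L) (hd : 1 ≤ d) (U : ZdEdge d → 𝔸ˣ) (hU : ∀ b, U b ∈ U1 𝔸)
    {g : (Fin d → ℤ) → 𝔸ˣ} (hg : ∀ z, g z ∈ U1 𝔸) {ε₀ : ℝ} (hε₀ : 0 ≤ ε₀)
    (hsm : ((d : ℝ) * L) ^ 2 * ε₀ ≤ 1 / 100)
    (h44 : ∀ (p : Fin d → ℤ) (i j : Fin d), i ≠ j → ‖((plaquetteHolonomyZd U p i j : 𝔸ˣ) : 𝔸) - 1‖ ≤ ε₀) :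
    avgBar L (gaugeTransformZd g U) = gaugeTransformZd (g ∘ blockBase L) (avgBar L U) := by
  funext c
  rw [avgBar_gaugeTransformZd hL hd U hU hg hε₀ hsm h44 c]
  rfl

end Normed

/-! ## § 3  Gauge covariance of the `k`-fold (0.12)/(0.11) average -/

section CStar

variable {𝔸 : Type*} [CStarAlgebra 𝔸] [Nontrivial 𝔸] {L : ℕ}

/-- [cite: Balaban1987RG1, (0.12) p.254][cite: Balaban1985Averaging, (11) p.19] **GAUGE COVARIANCE OF THE
`k`-FOLD (0.12)/(0.11) AVERAGE**: under the hypotheses of [B7] Proposition 2 for unitary configurations in a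
C⋆-algebra (`B12Average012Prop2.prop2_012`: (52) `sup_p ‖U(∂p) − 1‖ < α₀η²`, `η = L^{−k}`, `C₀α₀ ≤ 1/3`,
`2α₀ ≤ c₂′`) and for a unitary gauge function `g`, every level transforms with `g` restricted to the corners of
the `L^j`-cubes: `\overline{(U^g)}^j = (Ū^j)^{g∘(L^j·)}`, `j ≤ k` — induction on `j` with the one-step covariance
(11) of [12] for [I]'s average (`B12Average012Covariance.avgBar_gaugeTransformZd`), applicable at level `j`
because `Ū^j` is unitary and `ε`-regular with `ε < 2α₀ ≤ c₂′` by (54) at level `j`. -/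
theorem avgIter012_gaugeTransformZd (hL : 2 ≤ L) (hd : 1 ≤ d) (k : ℕ) (U : ZdEdge d → 𝔸ˣ)
    (hU : ∀ b, U b ∈ unitaryUnits 𝔸) {g : (Fin d → ℤ) → 𝔸ˣ} (hg : ∀ z, g z ∈ unitaryUnits 𝔸) {α₀ : ℝ}
    (hα : 0 < α₀) (hα3 : C0A d * α₀ ≤ 1 / 3) (hα2 : 2 * α₀ ≤ c2' d L)
    (h52 : pdevZ U < α₀ * (((L : ℝ) ^ k)⁻¹) ^ 2) :
    ∀ j ≤ k, avgIter012 L (gaugeTransformZd g U) j = gaugeTransformZd (g ∘ blockBase (L ^ j)) (avgIter012 L U j) := by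
  have hL1 : 1 ≤ L := le_trans (by norm_num) hL
  have hL0 : 0 < L := hL1
  have hL1r : (1 : ℝ) ≤ L := by exact_mod_cast hL1
  have hg1 : ∀ z, g z ∈ U1 𝔸 := fun z => unitaryUnits_le_U1 (hg z)
  -- `2α₀ ≤ c₂′` forces `(dL)²·2α₀ ≤ 1/512`
  have hsm2 : ((d : ℝ) * L) ^ 2 * (2 * α₀) ≤ 1 / 512 := by
    have hpos : (0 : ℝ) < 512 * ((d : ℝ) + 1) * (d + 4) * (L : ℝ) ^ 2 := by positivity
    have h1 : 2 * α₀ ≤ 1 / (512 * ((d : ℝ) + 1) * (d + 4) * (L : ℝ) ^ 2) := hα2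
    rw [le_div_iff₀ hpos] at h1
    have h2 : ((d : ℝ) * L) ^ 2 ≤ (d + 1) * (d + 4) * (L : ℝ) ^ 2 := by
      have : (d : ℝ) ^ 2 ≤ (d + 1) * (d + 4) := by nlinarith
      have hL2 : (0 : ℝ) ≤ (L : ℝ) ^ 2 := by positivity
      nlinarith
    have h3 : 0 ≤ 2 * α₀ := by linarith
    nlinarith [mul_le_mul_of_nonneg_right h2 h3]
  -- (52) at level `k` implies (52) at every level `j ≤ k`
  have h52j : ∀ j ≤ k, pdevZ U < α₀ * (((L : ℝ) ^ j)⁻¹) ^ 2 := by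
    intro j hj
    refine h52.trans_le (mul_le_mul_of_nonneg_left ?_ hα.le)
    have hjk : (L : ℝ) ^ j ≤ (L : ℝ) ^ k := pow_le_pow_right₀ hL1r hj
    have hj0 : (0 : ℝ) < (L : ℝ) ^ j := by positivity
    gcongr
  intro j
  induction j with
  | zero =>
      intro _
      rw [avgIter012_zero, avgIter012_zero, pow_zero]
      congr 1
      funext y
      simp only [Function.comp_apply, blockBase_one]
  | succ j ih =>
      intro hjk
      have hjk' : j ≤ k := Nat.le_of_succ_le hjk
      have hmem := (prop2_012 hL hd j U hU hα hα3 hα2 (h52j j hjk')).2 j le_rfl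
      have hU1j : ∀ b, avgIter012 L U j b ∈ U1 𝔸 := fun b => unitaryUnits_le_U1 (hmem b)
      have hlt : pdevZ (avgIter012 L U j) < 2 * α₀ := prop2_012_lt_two hL hd j U hU hα hα3 hα2 (h52j j hjk')
      set ε : ℝ := pdevZ (avgIter012 L U j) with hε
      have hε0 : 0 ≤ ε := pdevZ_nonneg _
      have hdl : 0 ≤ ((d : ℝ) * L) ^ 2 := by positivity
      have hsm : ((d : ℝ) * L) ^ 2 * ε ≤ 1 / 100 := by
        have := mul_le_mul_of_nonneg_left hlt.le hdl
        linarith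
      have h44 : ∀ (x : Fin d → ℤ) (i i' : Fin d), i ≠ i' →
          ‖((plaquetteHolonomyZd (avgIter012 L U j) x i i' : 𝔸ˣ) : 𝔸) - 1‖ ≤ ε :=
        fun x i i' _ => le_pdevZ hU1j x i i'
      have hgj : ∀ z, (g ∘ blockBase (L ^ j)) z ∈ U1 𝔸 := fun z => hg1 _
      rw [avgIter012_succ, avgIter012_succ, ih hjk', avgBar_gaugeTransformZd_cfg hL0 hd _ hU1j hgj hε0 hsm h44,
        comp_blockBase_pow_succ]

/-- [cite: Balaban1987RG1, p.254] **(52) AND (54) ARE GAUGE INVARIANT, THE AVERAGES GAUGE COVARIANT**: for unitary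
`U`, `g` under the hypotheses of `B12Average012Prop2.prop2_012`, the gauge transform `U^g` satisfies the same
hypotheses (`pdevZ_gaugeTransformZd`), its `k`-fold average is `(Ū^k)^{g∘(L^k·)}` and obeys (54):
`sup_p ‖\overline{(U^g)}^k(∂p) − 1‖ = sup_p ‖Ū^k(∂p) − 1‖ < α₀ + 2C₀α₀²`. -/
theorem prop2_012_gaugeTransformZd (hL : 2 ≤ L) (hd : 1 ≤ d) (k : ℕ) (U : ZdEdge d → 𝔸ˣ)
    (hU : ∀ b, U b ∈ unitaryUnits 𝔸) {g : (Fin d → ℤ) → 𝔸ˣ} (hg : ∀ z, g z ∈ unitaryUnits 𝔸) {α₀ : ℝ}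
    (hα : 0 < α₀) (hα3 : C0A d * α₀ ≤ 1 / 3) (hα2 : 2 * α₀ ≤ c2' d L)
    (h52 : pdevZ U < α₀ * (((L : ℝ) ^ k)⁻¹) ^ 2) :
    pdevZ (gaugeTransformZd g U) < α₀ * (((L : ℝ) ^ k)⁻¹) ^ 2 ∧
      avgIter012 L (gaugeTransformZd g U) k = gaugeTransformZd (g ∘ blockBase (L ^ k)) (avgIter012 L U k) ∧
      pdevZ (avgIter012 L (gaugeTransformZd g U) k) = pdevZ (avgIter012 L U k) ∧
      pdevZ (avgIter012 L (gaugeTransformZd g U) k) < α₀ + 2 * C0A d * α₀ ^ 2 := by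
  have hg1 : ∀ z, g z ∈ U1 𝔸 := fun z => unitaryUnits_le_U1 (hg z)
  have hcov := avgIter012_gaugeTransformZd hL hd k U hU hg hα hα3 hα2 h52 k le_rfl
  have hinv : pdevZ (avgIter012 L (gaugeTransformZd g U) k) = pdevZ (avgIter012 L U k) := by
    rw [hcov, pdevZ_gaugeTransformZd (avgIter012 L U k) (g := g ∘ blockBase (L ^ k)) (fun z => hg1 _)]
  refine ⟨?_, hcov, hinv, ?_⟩
  · rw [pdevZ_gaugeTransformZd U hg1]; exact h52
  · rw [hinv]; exact (prop2_012 hL hd k U hU hα hα3 hα2 h52).1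

end CStar

end Literature.MathematicalPhysics.QuantumFieldTheory.Balaban1983to89.B12Average012CovarianceIter

end
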